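import Summits.HodgeConjecture.HodgeConjecture.Theorems.HCCMNonvacuityPrintedBinderTails   -- ★ B-p18 (g23) NONVAC-III: the parametric TAILS `hypLiu418_tail_inhabited`, `hyp413_tail_inhabited`
import Summits.HodgeConjecture.HodgeConjecture.Theorems.HCCMNonvacuityGaloisDatumCyc7   -- ★ p810711 NONVAC-II: the Galois datum `ℚ(ζ₇)` (`six_le_finrank_cyclo7`; brings ★ `HodgeCM.cyclo7`, ★ Landherr)
import Summits.HodgeConjecture.HodgeConjecture.Theorems.HCCMUnconditionalHDelOfF0   -- ★ p807981 `HDel_holds`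
import HarnessLib

/-!
# The ∀-telescopes of the two REMAINING printed-citation hypotheses are INHABITED — literal certificates (`HypLiu418`, `Hyp413`)

Cell `hodgecm-mathlib`, director g15 s459 ∕ s462 (a) ROW «NONVAC-II §3 — TELESCOPE CERTIFICATES», PART 2 (sequel of ★ p810866
`Theorems/HCCMNonvacuityBinderTelescopes.lean`, which certifies `Hyp411` ∕ `HypD3` ∕ `HypD1pp`).  HONEST LABEL: HC_CM is proved only modulo the
7 printed citations until rung 0 closes; this file proves NOTHING about Hodge classes and discharges no binder.  It certifies, LITERALLY, that
the two ∀-statements still OPEN as items — `HypLiu418` (stmt-HodgeConjecture-24832, [Liu2021] Thm. 4.18 as printed) and `Hyp413`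
(stmt-HodgeConjecture-24833, [Liu2021] Prop. 4.13 as printed) of `CorCM/D2Bridge/PrintedCitationHypothesesT.lean` — are NOT vacuously
satisfiable: for each, the statement obtained by copying its ∀-telescope BYTE FOR BYTE (script-extracted from the certificate module) and
replacing the conclusion by `False` is REFUTED — `¬ (∀ ‹binders verbatim›, False)`.  So whatever closes 24832 ∕ 24833 must prove
`Thm418AsPrinted …` ∕ `Prop413AsPrinted …` AT A REAL DATUM.

Division of labour (s462): the HEAD `(F, [IsGalois ℚ F], h6, ι₁, V)` is the Galois datum of ★ p810711 (`F := HodgeCM.cyclo7 = ℚ(ζ₇)`,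
`ι₁ := w.embedding` — so E's orientation `hemb : (InfinitePlace.mk ι₁).embedding = ι₁` holds by `InfinitePlace.mk_embedding` —, `V` by
Landherr ★ `HodgeCM.landherr_exists_proof`); the TAILS are B-p18 (g23)'s parametric ★ `NonvacuityBinderTails.hypLiu418_tail_inhabited`
(`a`, `Φ ∋ ι₁`, conjugate-symplectic weight-one `ν`, the conjugate record system `(R′, hR′)` by ★
`MuConjIdent.exists_recordSystemConj_X_sec42DataOf_levelOf_eq` at `hDel := HDel_holds`, `Φ′`) and ★ `NonvacuityBinderTails.hyp413_tail_inhabited`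
(`Φ ∋ ι₁`, the pinned Liu index `i : I V (repAt a₀) (muLiu ι₁ GramClass.rep)` by ★ `IndexInhabited.nonempty_index` under `hemb`).

0 `def`, 0 `instance`, 0 `notation`, 0 `axiom`, 0 `sorry`; theorems only; the `open` block is the certificate module's, verbatim.  Filed
`--kind proof --supports stmt-HodgeConjecture-24832 --as helper`.
-/

set_option autoImplicit false

noncomputable section

namespace Summit.HodgeConjecture.HodgeConjecture.Theorems.HCCMNonvacuityBinderTelescopesLiu418H413
open scoped TensorProduct Matrix
open NumberField NumberField.InfinitePlace
open HodgeCM.Model HodgeCM.Model.LiuIndex HodgeCM.Model.TowerCarrier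
open HodgeCM.Literature.Theta.LiuAlbaneseModuleDatum.D2Bridge (HcmPieces)
open Summit.HodgeConjecture.CorCM.Model
open Literature.AlgebraicGeometry.Motives (CMType)
open Literature.AlgebraicGeometry.HodgeTheory Literature.NumberTheory.Automorphic.PicardCM
open Literature.AlgebraicGeometry.ShimuraVarieties.UnitaryCanonicalModel
open Literature.NumberTheory.ComplexMultiplication
open Literature.NumberTheory.Automorphic
open Literature.NumberTheory.Automorphic.IdeleClassGroup (toHeckeCharacter isUnitary_toHeckeCharacter galConj)
open Literature.NumberTheory.Automorphic.Liu2021 Literature.NumberTheory.Automorphic.Liu2021.AppendixC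
open Literature.NumberTheory.Automorphic.Liu2021.AppendixC.RestOne
open Literature.NumberTheory.Automorphic.Liu2021.Def411WeilCarriers (lineOf locF Rep)
open Summit.HodgeConjecture.CorCM.Transposition.OmegaTransport (realUnit)
open HodgeCM.Model.ArchSideTerm (e₁)
open Literature.NumberTheory.GelbartRogawski1991 Literature.NumberTheory.GelbartRogawski1991.UnitaryDualPair
open Literature.NumberTheory.GelbartRogawski1991.UnitaryDualPair.LocalSplitting (localMu norm_localMu continuous_localMu localMu_toLocalRing_eq_one_iff
  eq_of_forall_localMu_toHeckeCharacter_eq)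
open Literature.RepresentationTheory Literature.RepresentationTheory.Liu2021
open Summit.HodgeConjecture.CorCM.Transposition
open Summit.HodgeConjecture.CorCM.D2Bridge.AdapterMuConj (muConj prop413AsPrinted_muConj def411_muConj nontrivial_omegaAt_muConj_rest)
open Summit.HodgeConjecture.CorCM.D2Bridge.MuKeyIdentEnd (hc_cm_of_printed_citations_muKey_ident)
open Summit.HodgeConjecture.CorCM.D2Bridge.MuKeyIdentLemD3End
open Summit.HodgeConjecture.CorCM.D2Bridge.MuKeyIdentLemD3DelRecConjOmegaEnd (diagonal_frameD_map_complexConj)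
open Summit.HodgeConjecture.CorCM.D2Bridge.MuKeyIdentLemD3DelRecConjOmegaEndT

set_option linter.dupNamespace false in
/-- **`HypLiu418`'s ∀-telescope (item stmt-HodgeConjecture-24832) is inhabited** — binders `hDel, F, [IsGalois ℚ F], h6, ι₁, V, a, Φ, hΦ, ν, hν, hw, R′, hR′, Φ′` copied byte for byte from `PrintedCitationHypothesesT.HypLiu418`, conclusion replaced by `False`, the whole refuted.  Witness: head = the Galois datum `ℚ(ζ₇)` of ★ p810711 with `hDel := HDel_holds`; tail = ★ `NonvacuityBinderTails.hypLiu418_tail_inhabited HDel_holds F h6 V` (B-p18 (g23)).  Consequently a proof of `HypLiu418` cannot be vacuous: it must establish [Liu2021, Thm. 4.18] as printed at this datum. [cite: Liu2021, Thm 4.18 p. 52] [cite: Deligne1979ShimuraVarieties, §2.2.5 and Cor. 2.7.21] -/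
theorem hypLiu418_telescope_inhabited :
    ¬ (∀ (hDel : Literature.AlgebraicGeometry.ShimuraVarieties.UnitaryCanonicalModel.canonicalModel_exists_printed),
      ∀ (F : HodgeCM.CMField) [IsGalois ℚ F] (h6 : 6 ≤ Module.finrank ℚ F) {ι₁ : F →+* ℂ} (V : HodgeCM.HermSpace3 F ι₁) (a : RealScalar F)
      (Φ : CMType F) (hΦ : ι₁ ∈ Φ.1) (ν : Literature.NumberTheory.Automorphic.IdeleClassGroup (F : Type) →ₜ* Circle)
      (hν : IdeleClassGroup.IsConjugateSymplectic (F : Type) ν) (hw : IdeleClassGroup.HasWeight (F : Type) ν 1)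
      (R' : RecordSystem (HodgeCM.CMField.K F) (Summit.HodgeConjecture.CorCM.Model.RecordSystemConj.conjGram (HodgeCM.CMField.K F) (HodgeCM.HermSpace3.Hm V)) ι₁
        (Summit.HodgeConjecture.CorCM.Model.RecordSystemConj.conjFrame (Summit.HodgeConjecture.CorCM.Model.frameOf (⟨HodgeCM.HermSpace3.Hm V, HodgeCM.HermSpace3.isHermitian V, HodgeCM.HermSpace3.signature_ι₁ V, HodgeCM.HermSpace3.posDef_of_ne V⟩ : Summit.HodgeConjecture.CorCM.HermSpace3 ⟨HodgeCM.CMField.K F⟩ ι₁)))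
        (Summit.HodgeConjecture.CorCM.Model.RecordSystemConj.formCongr_conjFrame (HodgeCM.CMField.K F) (HodgeCM.HermSpace3.Hm V) ι₁ (Summit.HodgeConjecture.CorCM.Model.frameOf (⟨HodgeCM.HermSpace3.Hm V, HodgeCM.HermSpace3.isHermitian V, HodgeCM.HermSpace3.signature_ι₁ V, HodgeCM.HermSpace3.posDef_of_ne V⟩ : Summit.HodgeConjecture.CorCM.HermSpace3 ⟨HodgeCM.CMField.K F⟩ ι₁))
          (Summit.HodgeConjecture.CorCM.Model.formCongr_frameOf (⟨HodgeCM.HermSpace3.Hm V, HodgeCM.HermSpace3.isHermitian V, HodgeCM.HermSpace3.signature_ι₁ V, HodgeCM.HermSpace3.posDef_of_ne V⟩ : Summit.HodgeConjecture.CorCM.HermSpace3 ⟨HodgeCM.CMField.K F⟩ ι₁)))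
        (Summit.HodgeConjecture.CorCM.Model.RecordSystemConj.conjLevel₀ (HodgeCM.CMField.K F) (HodgeCM.HermSpace3.Hm V) (Summit.HodgeConjecture.CorCM.HComp.K3 (⟨HodgeCM.HermSpace3.Hm V, HodgeCM.HermSpace3.isHermitian V, HodgeCM.HermSpace3.signature_ι₁ V, HodgeCM.HermSpace3.posDef_of_ne V⟩ : Summit.HodgeConjecture.CorCM.HermSpace3 ⟨HodgeCM.CMField.K F⟩ ι₁))))
      (hR' : CategoryTheory.Functor.comp (Summit.HodgeConjecture.CorCM.Model.RecordSystemConj.smallLevelConjBack (HodgeCM.CMField.K F) (HodgeCM.HermSpace3.Hm V) (Summit.HodgeConjecture.CorCM.HComp.K3 (⟨HodgeCM.HermSpace3.Hm V, HodgeCM.HermSpace3.isHermitian V, HodgeCM.HermSpace3.signature_ι₁ V, HodgeCM.HermSpace3.posDef_of_ne V⟩ : Summit.HodgeConjecture.CorCM.HermSpace3 ⟨HodgeCM.CMField.K F⟩ ι₁))) (Summit.HodgeConjecture.CorCM.Model.sec42DataOfFourLe (Summit.HodgeConjecture.CorCM.DelRec.exists_recordSystem_of_printed hDel) (⟨HodgeCM.HermSpace3.Hm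 V, HodgeCM.HermSpace3.isHermitian V, HodgeCM.HermSpace3.signature_ι₁ V, HodgeCM.HermSpace3.posDef_of_ne V⟩ : Summit.HodgeConjecture.CorCM.HermSpace3 ⟨HodgeCM.CMField.K F⟩ ι₁) Φ (le_trans (Nat.le_of_ble_eq_true rfl) h6) (isoOf ⟨HodgeCM.CMField.K F⟩ ι₁ (⟨HodgeCM.HermSpace3.Hm V, HodgeCM.HermSpace3.isHermitian V, HodgeCM.HermSpace3.signature_ι₁ V, HodgeCM.HermSpace3.posDef_of_ne V⟩ : Summit.HodgeConjecture.CorCM.HermSpace3 ⟨HodgeCM.CMField.K F⟩ ι₁) Φ)).cpt.X = R'.M ∧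
        ∀ K : Subgroup (Summit.HodgeConjecture.CorCM.Model.honestP5Of (Summit.HodgeConjecture.CorCM.DelRec.exists_recordSystem_of_printed hDel) ⟨HodgeCM.CMField.K F⟩ ι₁ ⟨HodgeCM.HermSpace3.Hm V, HodgeCM.HermSpace3.isHermitian V, HodgeCM.HermSpace3.signature_ι₁ V, HodgeCM.HermSpace3.posDef_of_ne V⟩ Φ).G,
          (sec42DataOf (Summit.HodgeConjecture.CorCM.DelRec.exists_recordSystem_of_printed hDel) isoOf ⟨HodgeCM.CMField.K F⟩ ι₁ ⟨HodgeCM.HermSpace3.Hm V, HodgeCM.HermSpace3.isHermitian V, HodgeCM.HermSpace3.signature_ι₁ V, HodgeCM.HermSpace3.posDef_of_ne V⟩ Φ).X ((sec42DataOf (Summit.HodgeConjecture.CorCM.DelRec.exists_recordSystem_of_printed hDel) isoOf ⟨HodgeCM.CMField.K F⟩ ι₁ ⟨HodgeCM.HermSpace3.Hm V, HodgeCM.HermSpace3.isHermitian V, HodgeCM.HermSpace3.signature_ι₁ V, HodgeCM.HermSpace3.posDef_of_ne V⟩ Φ).levelOf K) =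
            R'.M.obj (⟨C5.OpenCompactSubgroup.transport (Summit.HodgeConjecture.CorCM.Model.RecordSystemConj.groupConj (HodgeCM.CMField.K F) (HodgeCM.HermSpace3.Hm V)) ((Summit.HodgeConjecture.CorCM.Model.sec42DataOfFourLe (Summit.HodgeConjecture.CorCM.DelRec.exists_recordSystem_of_printed hDel) (⟨HodgeCM.HermSpace3.Hm V, HodgeCM.HermSpace3.isHermitian V, HodgeCM.HermSpace3.signature_ι₁ V, HodgeCM.HermSpace3.posDef_of_ne V⟩ : Summit.HodgeConjecture.CorCM.HermSpace3 ⟨HodgeCM.CMField.K F⟩ ι₁) Φ (le_trans (Nat.le_of_ble_eq_true rfl) h6) (isoOf ⟨HodgeCM.CMField.K F⟩ ι₁ (⟨HodgeCM.HermSpace3.Hm V, HodgeCM.HermSpace3.isHermitian V, HodgeCM.HermSpace3.signature_ι₁ V, HodgeCM.HermSpace3.posDef_of_ne V⟩ : Summit.HodgeConjecture.CorCM.HermSpace3 ⟨HodgeCM.CMField.K F⟩ ι₁) Φ)).levelOf K).1,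
              C5.OpenCompactSubgroup.transport_mono (Summit.HodgeConjecture.CorCM.Model.RecordSystemConj.groupConj (HodgeCM.CMField.K F) (HodgeCM.HermSpace3.Hm V)) ((Summit.HodgeConjecture.CorCM.Model.sec42DataOfFourLe (Summit.HodgeConjecture.CorCM.DelRec.exists_recordSystem_of_printed hDel) (⟨HodgeCM.HermSpace3.Hm V, HodgeCM.HermSpace3.isHermitian V, HodgeCM.HermSpace3.signature_ι₁ V, HodgeCM.HermSpace3.posDef_of_ne V⟩ : Summit.HodgeConjecture.CorCM.HermSpace3 ⟨HodgeCM.CMField.K F⟩ ι₁) Φ (le_trans (Nat.le_of_ble_eq_true rfl) h6) (isoOf ⟨HodgeCM.CMField.K F⟩ ι₁ (⟨HodgeCM.HermSpace3.Hm V, HodgeCM.HermSpace3.isHermitian V, HodgeCM.HermSpace3.signature_ι₁ V, HodgeCM.HermSpace3.posDef_of_ne V⟩ : Summit.HodgeConjecture.CorCM.HermSpace3 ⟨HodgeCM.CMField.K F⟩ ι₁) Φ)).levelOf K).2⟩ :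
              C5.SmallLevel (Summit.HodgeConjecture.CorCM.Model.RecordSystemConj.conjLevel₀ (HodgeCM.CMField.K F) (HodgeCM.HermSpace3.Hm V) (Summit.HodgeConjecture.CorCM.HComp.K3 (⟨HodgeCM.HermSpace3.Hm V, HodgeCM.HermSpace3.isHermitian V, HodgeCM.HermSpace3.signature_ι₁ V, HodgeCM.HermSpace3.posDef_of_ne V⟩ : Summit.HodgeConjecture.CorCM.HermSpace3 ⟨HodgeCM.CMField.K F⟩ ι₁)))))
      (Φ' : CMType F),
      False) := by
  intro h
  obtain ⟨w⟩ := (inferInstance : Nonempty (InfinitePlace (HodgeCM.cyclo7 : Type)))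
  obtain ⟨V⟩ := HodgeCM.landherr_exists_proof HodgeCM.cyclo7 w.embedding
  haveI : IsGalois ℚ HodgeCM.cyclo7 := HodgeCM.cyclo7_isGalois
  obtain ⟨a, Φ, hΦ, ν, hν, hw, R', Φ', hR'⟩ :=
    Summit.HodgeConjecture.CorCM.D2Bridge.MuKeyIdentLemD3DelRecConjOmegaEndT.NonvacuityBinderTails.hypLiu418_tail_inhabited Summit.HodgeConjecture.HodgeConjecture.Theorems.HCCMUnconditionalHDelOfF0.HDel_holds HodgeCM.cyclo7 Summit.HodgeConjecture.HodgeConjecture.Theorems.HCCMNonvacuityGaloisDatumCyc7.six_le_finrank_cyclo7 V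
  exact h Summit.HodgeConjecture.HodgeConjecture.Theorems.HCCMUnconditionalHDelOfF0.HDel_holds HodgeCM.cyclo7 Summit.HodgeConjecture.HodgeConjecture.Theorems.HCCMNonvacuityGaloisDatumCyc7.six_le_finrank_cyclo7 V a Φ hΦ ν hν hw R' hR' Φ'

set_option linter.dupNamespace false in
/-- **`Hyp413`'s ∀-telescope (item stmt-HodgeConjecture-24833) is inhabited** — binders `hDel, F, [IsGalois ℚ F], h6, ι₁, V, a₀, Φ, hΦ, i` copied byte for byte from `PrintedCitationHypothesesT.Hyp413`, conclusion replaced by `False`, the whole refuted.  Witness: head = the Galois datum `ℚ(ζ₇)` of ★ p810711 at `ι₁ := w.embedding`, where E's orientation `hemb : (InfinitePlace.mk ι₁).embedding = ι₁` holds by `InfinitePlace.mk_embedding` (at `conj ∘ ι₁` the pinned index is EMPTY, ★ `H413IndexEmptyOfEmbeddingNe` — orientation is part of the statement); `a₀ := 1`; tail = ★ `NonvacuityBinderTails.hyp413_tail_inhabited F hemb V a₀` (B-p18 (g23); the index by ★ `IndexInhabited.nonempty_index`).  Consequently a proof of `Hyp413` cannot be vacuous: it must establish [Liu2021, Prop.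 4.13] as printed at this datum. [cite: Liu2021, Prop. 4.13 p. 47 and Def. 4.12 p. 47] -/
theorem hyp413_telescope_inhabited :
    ¬ (∀ (hDel : Literature.AlgebraicGeometry.ShimuraVarieties.UnitaryCanonicalModel.canonicalModel_exists_printed),
      ∀ (F : HodgeCM.CMField) [IsGalois ℚ F] (h6 : 6 ≤ Module.finrank ℚ F) {ι₁ : F →+* ℂ} (V : HodgeCM.HermSpace3 F ι₁) (a₀ : RealScalar F)
      (Φ : CMType F) (hΦ : ι₁ ∈ Φ.1) (i : (I V (repAt a₀) (muLiu ι₁ GramClass.rep))),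
      False) := by
  intro h
  obtain ⟨w⟩ := (inferInstance : Nonempty (InfinitePlace (HodgeCM.cyclo7 : Type)))
  have hemb : (InfinitePlace.mk w.embedding).embedding = w.embedding := by rw [InfinitePlace.mk_embedding]
  obtain ⟨V⟩ := HodgeCM.landherr_exists_proof HodgeCM.cyclo7 w.embedding
  haveI : IsGalois ℚ HodgeCM.cyclo7 := HodgeCM.cyclo7_isGalois
  obtain ⟨Φ, hΦ, ⟨i⟩⟩ :=
    Summit.HodgeConjecture.CorCM.D2Bridge.MuKeyIdentLemD3DelRecConjOmegaEndT.NonvacuityBinderTails.hyp413_tail_inhabited HodgeCM.cyclo7 hemb V ⟨1, map_one _, one_ne_zero⟩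
  exact h Summit.HodgeConjecture.HodgeConjecture.Theorems.HCCMUnconditionalHDelOfF0.HDel_holds HodgeCM.cyclo7 Summit.HodgeConjecture.HodgeConjecture.Theorems.HCCMNonvacuityGaloisDatumCyc7.six_le_finrank_cyclo7 V ⟨1, map_one _, one_ne_zero⟩ Φ hΦ i

end Summit.HodgeConjecture.HodgeConjecture.Theorems.HCCMNonvacuityBinderTelescopesLiu418H413

end
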